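import Literature.NumberTheory.Automorphic.UnitaryCurveCotangentSpectralProjection
import Literature.NumberTheory.Automorphic.UnitaryGroupCotangentSpectralProjectionConj
import HarnessLib

/-!
# Rank two: the ANTIHOLOMORPHIC spectral-projection letter (D₂)⁻ `antiholCotFormSpectralProjection₂` from the holomorphic one (D₂)⁺
# `holCotFormSpectralProjection₂` (and back) by complex conjugation on `L²`

Topic `NumberTheory/Automorphic`; namespace `Literature.NumberTheory.Automorphic.UnitaryCurveForms` (the namespace of the rank-2 cone carriers ★
`UnitaryCurveCohCotangentForms` and of the two named facts ★ `UnitaryCurveCotangentSpectralProjection`).  PROOF FILE: theorems only — no definition,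
no named fact, no instance, no `sorry`.  Rank-2 SCALAR twin of ★ `UnitaryGroupCotangentSpectralProjectionConj` ((D̄) ⟺ (D) at rank 3, F0P2-p01 (g2)),
over the same tree tools: ★ `AutomorphicConjugate` (`conjL2 = star` on `L²(U(H)(L⁺) A \ U(H)(𝔸_{L⁺}), μ)`, `conjL2_toLp`), ★
`DiscreteAutomorphicRep.conj` ∕ `DiscreteAutomorphicRep.starProjection_star` (`pr_P (f̄) = \overline{pr_{P̄} (f)}`), and the conjugate-linear map ★
`conjFun₂` (`conjFun₂ f x = \overline{f x}`) whose image of `holCotForms₂ … 𝔣` IS the space of antiholomorphic cotangent cone forms in the statement of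
(D₂)⁻.

WHY ([BorelJacquet1979, §4.6]; [BorelWallach2000, VII 2.10]: complex conjugation exchanges the `(1,0)` and `(0,1)` forms).  For `f = \overline{f₀}` with
`f₀ ∈ holCotForms₂ … 𝔣` square-integrable on the quotient: `pr_P [f] = pr_P \overline{[f₀]} = \overline{pr_{P̄} [f₀]} = \overline{[f₀′]} = [\overline{f₀′}]`
with `f₀′ ∈ holCotForms₂ … 𝔣` the form that (D₂)⁺ provides for the conjugate discrete automorphic `P̄` and `f₀`; conversely with `P̄̄ = P`, `\overline{\overline{f}} = f`.
Hence **(D₂)⁺ for all `P` ⟺ (D₂)⁻ for all `P`**: the two rank-2 named facts are ONE debt.  CONSUMER: the sub-sub-line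
`Summits/…/Cruxes/HLiu418/Lines/F0_AlbCmS1bHodge.lean` (ED. 2, floor-0 programme P5 of the Hodge-CM cell) carries the named-fact stubs
`stub_TPhol : holCotFormSpectralProjection₂` and `stub_TPantihol : antiholCotFormSpectralProjection₂`; with this file
`stub_TPantihol := UnitaryCurveForms.antiholCotFormSpectralProjection₂_of_hol stub_TPhol`.  HC_CM is proved only modulo the printed citations until
rung 0 closes; this file discharges none of them and changes no count (it makes one of two declared debts a consequence of the other).

* `toQuotFun_conjFun₂` — reading `\overline{f}` on the quotient gives the conjugate function (`rfl`);
* `memLp_toQuotFun_conjFun₂_iff` — `[\overline{f}] ∈ L²` iff `[f] ∈ L²`;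
* `toLp_toQuotFun_conjFun₂` — the class of `\overline{f}` is `star` of the class of `f` (★ `conjL2_toLp`);
* `antiholCotFormSpectralProjection₂_of_hol`, `holCotFormSpectralProjection₂_of_antihol`, `holCotFormSpectralProjection₂_iff_antihol`.

ED. 2 (F0P5-p03 (g2) for the file's author A-p06 (g18); desk ruling R1 (α-lite) ∕ road (i′) 2026-08-31T02:30:56Z; statements byte-identical,
proof-only): the two transfer proofs are SHAPE-ROBUST — after `intro … hg` the remaining binders are introduced anonymously and the letter is applied as
`apply hD L ι H dV hdV hdV0 t ht g hg; all_goals assumption` — so they elaborate against the letters as first typed AND against the letters with the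
binder `(H.map (cmPlace L ι).1.embedding).IsHermitian` inserted after the diagonalisation (the honest domain: [BorelJacquet1979, §4.6] concerns the unitary
group of a hermitian form); the letters can then be sharpened in place with this file re-elaborating unchanged.

## References
* [BorelJacquet1979] A. Borel, H. Jacquet, *Automorphic forms and automorphic representations*, PSPM 33.1 (1979), §4.6.
* [BorelWallach2000] A. Borel, N. Wallach, *Continuous cohomology, discrete subgroups, and representations of reductive groups*, 2nd ed. (2000),
  VII 2.10, 3.2.
* [Bump1997] D. Bump, *Automorphic forms and representations* (1997), proof of Thm. 3.6.1, p. 342 (equivariance of `pr_P`).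
-/

noncomputable section

open MeasureTheory NumberField NumberField.InfinitePlace
open scoped Matrix ComplexOrder

namespace Literature.NumberTheory.Automorphic.UnitaryCurveForms

open Literature.NumberTheory.Automorphic.UnitaryGroup
open Literature.NumberTheory.Automorphic.UnitaryGroup.CotangentForms (toQuotFun)

/-! ## §1 Junction: `conjFun₂` read on the quotient and in `L²` -/

section Junction

variable {F E : Type} [Field F] [NumberField F] [Field E] [NumberField E] [Algebra F E] (c : E ≃ₐ[F] E)
  (J : Matrix (Fin 2) (Fin 2) E)

/-- Reading the conjugate `\overline{f} = conjFun₂ f` on the automorphic quotient gives the conjugate function (definitional: `toQuotFun` evaluates at a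
chosen representative). [cite: BorelWallach2000, VII 2.10] -/
theorem toQuotFun_conjFun₂ (f : (adelicGroupData F E c 2 J).Adelic → ℂ) :
    toQuotFun (adelicGroupData F E c 2 J) (conjFun₂ F E c J f) = star (toQuotFun (adelicGroupData F E c 2 J) f) := rfl

variable {μ : Measure (adelicGroupData F E c 2 J).automorphicQuotient}

/-- `[\overline{f}]` is square-integrable on the quotient iff `[f]` is. [cite: BorelJacquet1979, §4.6] -/
theorem memLp_toQuotFun_conjFun₂_iff (f : (adelicGroupData F E c 2 J).Adelic → ℂ) :
    MemLp (toQuotFun (adelicGroupData F E c 2 J) (conjFun₂ F E c J f)) 2 μ ↔ MemLp (toQuotFun (adelicGroupData F E c 2 J) f) 2 μ := by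
  rw [toQuotFun_conjFun₂]
  refine ⟨fun h => ?_, fun h => h.star⟩
  have h' := h.star
  rwa [star_star] at h'

/-- **The class of `\overline{f}` is the conjugate (`star`) of the class of `f`** (★ `conjL2_toLp`). [cite: BorelJacquet1979, §4.6] -/
theorem toLp_toQuotFun_conjFun₂ (f : (adelicGroupData F E c 2 J).Adelic → ℂ) (hf : MemLp (toQuotFun (adelicGroupData F E c 2 J) f) 2 μ)
    (hf' : MemLp (toQuotFun (adelicGroupData F E c 2 J) (conjFun₂ F E c J f)) 2 μ) :
    hf'.toLp _ = star (hf.toLp _) := by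
  rw [← AdelicGroupData.conjL2_apply, AdelicGroupData.conjL2_toLp]
  rfl

end Junction

/-! ## §2 (D₂)⁺ ⟺ (D₂)⁻ -/

/-- **(D₂)⁺ ⟹ (D₂)⁻: the spectral projection of an ANTIholomorphic cotangent cone form is antiholomorphic, GIVEN the holomorphic letter.**  For
`f = \overline{f₀}` with `f₀ ∈ holCotForms₂ … 𝔣`: `pr_P [f] = pr_P \overline{[f₀]} = \overline{pr_{P̄} [f₀]} = \overline{[f₀′]} = [\overline{f₀′}]` with `f₀′` the
holomorphic cotangent cone form that (D₂)⁺ provides for `P̄` (★ `DiscreteAutomorphicRep.conj`) and `f₀`. [cite: BorelJacquet1979, §4.6]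
[cite: BorelWallach2000, VII 2.10] -/
theorem antiholCotFormSpectralProjection₂_of_hol (hD : holCotFormSpectralProjection₂) : antiholCotFormSpectralProjection₂ := by
  intro L _ _ _ ι H dV hdV hdV0 t ht g hg
  -- ed. 2 (shape-robust): the binders after the diagonalisation — with or without a hermitian hypothesis on `σ_{w(ι)}H` — are
  -- introduced anonymously; only the trailing data is named
  intros
  rename_i 𝔣 μ _ P f hfmem hf
  obtain ⟨f₀, hf₀, rfl⟩ := Submodule.mem_map.mp hfmem
  have hf₀L : MemLp (toQuotFun (adelicGroupData (↥(maximalRealSubfield L)) L (IsCMField.complexConj L) 2 H) f₀) 2 μ :=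
    (memLp_toQuotFun_conjFun₂_iff (IsCMField.complexConj L) H f₀).mp hf
  -- (D₂)⁺ for `P̄` and `f₀`: the letter applied up to the diagonalisation, every remaining hypothesis found in context
  obtain ⟨f₀', hf₀', hf₀'L, heq⟩ :
      ∃ f₀' ∈ holCotForms₂ (↥(maximalRealSubfield L)) L (IsCMField.complexConj L) H (IsCMField.complexConj_ne_one L)
          (UnitaryGroup.complexConj_smul_infinitePlace L) (cmPlace L ι) 𝔣,
        ∃ hf₀'L : MemLp (toQuotFun (adelicGroupData (↥(maximalRealSubfield L)) L (IsCMField.complexConj L) 2 H) f₀') 2 μ,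
          P.conj.space.toSubmodule.starProjection
              (MemLp.toLp (toQuotFun (adelicGroupData (↥(maximalRealSubfield L)) L (IsCMField.complexConj L) 2 H) f₀) hf₀L) =
            MemLp.toLp (toQuotFun (adelicGroupData (↥(maximalRealSubfield L)) L (IsCMField.complexConj L) 2 H) f₀') hf₀'L := by
    apply hD L ι H dV hdV hdV0 t ht g hg
    all_goals assumption
  have hf'L : MemLp (toQuotFun (adelicGroupData (↥(maximalRealSubfield L)) L (IsCMField.complexConj L) 2 H)
      (conjFun₂ (↥(maximalRealSubfield L)) L (IsCMField.complexConj L) H f₀')) 2 μ :=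
    (memLp_toQuotFun_conjFun₂_iff (IsCMField.complexConj L) H f₀').mpr hf₀'L
  refine ⟨conjFun₂ (↥(maximalRealSubfield L)) L (IsCMField.complexConj L) H f₀', Submodule.mem_map_of_mem hf₀', hf'L, ?_⟩
  rw [toLp_toQuotFun_conjFun₂ (IsCMField.complexConj L) H f₀ hf₀L hf,
    toLp_toQuotFun_conjFun₂ (IsCMField.complexConj L) H f₀' hf₀'L hf'L, DiscreteAutomorphicRep.starProjection_star, heq]

/-- **(D₂)⁻ ⟹ (D₂)⁺**, by the same conjugation applied to `P̄` and `\overline{f}` (`\overline{P̄} = P`, `\overline{\overline{f}} = f`).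
[cite: BorelJacquet1979, §4.6] [cite: BorelWallach2000, VII 2.10] -/
theorem holCotFormSpectralProjection₂_of_antihol (hD' : antiholCotFormSpectralProjection₂) : holCotFormSpectralProjection₂ := by
  intro L _ _ _ ι H dV hdV hdV0 t ht g hg
  -- ed. 2 (shape-robust), as above
  intros
  rename_i 𝔣 μ _ P f₀ hf₀ hf₀L
  have hfL : MemLp (toQuotFun (adelicGroupData (↥(maximalRealSubfield L)) L (IsCMField.complexConj L) 2 H)
      (conjFun₂ (↥(maximalRealSubfield L)) L (IsCMField.complexConj L) H f₀)) 2 μ :=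
    (memLp_toQuotFun_conjFun₂_iff (IsCMField.complexConj L) H f₀).mpr hf₀L
  have hfmem : conjFun₂ (↥(maximalRealSubfield L)) L (IsCMField.complexConj L) H f₀ ∈
      (holCotForms₂ (↥(maximalRealSubfield L)) L (IsCMField.complexConj L) H (IsCMField.complexConj_ne_one L)
          (UnitaryGroup.complexConj_smul_infinitePlace L) (cmPlace L ι) 𝔣).map
        (conjFun₂ (↥(maximalRealSubfield L)) L (IsCMField.complexConj L) H) :=
    Submodule.mem_map_of_mem hf₀
  -- (D₂)⁻ for `P̄` and `\overline{f₀}`: the letter applied up to the diagonalisation, every remaining hypothesis found in context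
  obtain ⟨f', hf'mem, hf'L, heq⟩ :
      ∃ f' ∈ (holCotForms₂ (↥(maximalRealSubfield L)) L (IsCMField.complexConj L) H (IsCMField.complexConj_ne_one L)
          (UnitaryGroup.complexConj_smul_infinitePlace L) (cmPlace L ι) 𝔣).map
        (conjFun₂ (↥(maximalRealSubfield L)) L (IsCMField.complexConj L) H),
        ∃ hf'L : MemLp (toQuotFun (adelicGroupData (↥(maximalRealSubfield L)) L (IsCMField.complexConj L) 2 H) f') 2 μ,
          P.conj.space.toSubmodule.starProjection
              (MemLp.toLp (toQuotFun (adelicGroupData (↥(maximalRealSubfield L)) L (IsCMField.complexConj L) 2 H)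
                (conjFun₂ (↥(maximalRealSubfield L)) L (IsCMField.complexConj L) H f₀)) hfL) =
            MemLp.toLp (toQuotFun (adelicGroupData (↥(maximalRealSubfield L)) L (IsCMField.complexConj L) 2 H) f') hf'L := by
    apply hD' L ι H dV hdV hdV0 t ht g hg
    all_goals assumption
  obtain ⟨f₀', hf₀', rfl⟩ := Submodule.mem_map.mp hf'mem
  have hf₀'L : MemLp (toQuotFun (adelicGroupData (↥(maximalRealSubfield L)) L (IsCMField.complexConj L) 2 H) f₀') 2 μ :=
    (memLp_toQuotFun_conjFun₂_iff (IsCMField.complexConj L) H f₀').mp hf'L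
  refine ⟨f₀', hf₀', hf₀'L, ?_⟩
  -- conjugate the identity for `P̄`: `pr_{P̄} [\overline{f₀}] = [\overline{f₀′}]` ⟹ `pr_P [f₀] = [f₀′]`
  have key := heq
  rw [toLp_toQuotFun_conjFun₂ (IsCMField.complexConj L) H f₀ hf₀L hfL,
    toLp_toQuotFun_conjFun₂ (IsCMField.complexConj L) H f₀' hf₀'L hf'L, ← P.conj_conj,
    DiscreteAutomorphicRep.starProjection_star, DiscreteAutomorphicRep.conj_conj, star_inj] at key
  rw [P.conj_conj] at key
  exact key

/-- **(D₂)⁺ ⟺ (D₂)⁻**: the rank-2 holomorphic and antiholomorphic spectral-projection letters are ONE debt. [cite: BorelJacquet1979, §4.6]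
[cite: BorelWallach2000, VII 2.10] -/
theorem holCotFormSpectralProjection₂_iff_antihol : holCotFormSpectralProjection₂ ↔ antiholCotFormSpectralProjection₂ :=
  ⟨antiholCotFormSpectralProjection₂_of_hol, holCotFormSpectralProjection₂_of_antihol⟩

end Literature.NumberTheory.Automorphic.UnitaryCurveForms

end
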